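import Literature.Computability.Complexity.SkeletonTableau
import HarnessLib

/-!
# The quasi-linear tableau of a flat stack program, IV: the constraints as a flat family

Literature / circuit complexity (serves `williams_acc` through the leaf
`Williams2014_fact_3_1_skeleton`; see `SkeletonTableau.lean`). The conjunction `TabOK` of
local constraints is stated there family by family; here it is FLATTENED into one family of
six-variable Boolean constraints indexed by five numbers `(fam, κ, s, a, b)` — the shape the
clause-indexed presentation of the formula needs (`…Layout`): `conOf tb fam κ s a b : ACon`,
with `tabOK_iff : TabOK tb τ ↔ ∀ fam κ s a b, (conOf tb fam κ s a b).Sat τ`. Out-of-range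
indices yield the trivial constraint.
-/

namespace Literature.Computability.Complexity

namespace Tableau

open StackEvents FlatRun Benes

/-- A six-variable Boolean constraint over the tableau variables. [folklore] -/
structure ACon (K : ℕ) where
  /-- the variables -/
  (v₀ v₁ v₂ v₃ v₄ v₅ : TabVar K)
  /-- the relation among their values -/
  pred : Bool → Bool → Bool → Bool → Bool → Bool → Bool

/-- Satisfaction of a constraint by an assignment. [folklore] -/
def ACon.Sat {K : ℕ} (τ : TabVar K → Bool) (c : ACon K) : Prop :=
  c.pred (τ c.v₀) (τ c.v₁) (τ c.v₂) (τ c.v₃) (τ c.v₄) (τ c.v₅) = true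

/-- The trivial constraint. [folklore] -/
def ACon.triv (K : ℕ) : ACon K := ⟨.dummy, .dummy, .dummy, .dummy, .dummy, .dummy, fun _ _ _ _ _ _ => true⟩

/-- The trivial constraint is satisfied. [folklore] -/
@[simp] theorem ACon.sat_triv {K : ℕ} (τ : TabVar K → Bool) : (ACon.triv K).Sat τ := rfl

section Families

variable (tb : TabParams)

/-- Shorthand for a record variable. [folklore] -/
def rv (κ : Fin tb.K) (ℓ p w : ℕ) : TabVar tb.K := .r κ ℓ p w

/-- Family 0: virtual phase 1 records. [folklore] -/
def famRecV1 (s : ℕ) : ACon tb.K :=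
  if s < tb.Y then
    ⟨rv tb tb.inp 0 s fT1, rv tb tb.inp 0 s fT0, .yp (tb.Y - 1 - s), rv tb tb.inp 0 s fSym,
      .yv (tb.Y - 1 - s), .dummy, fun t1 t0 p sy v _ => decide (t1 = false ∧ t0 = p ∧ sy = v)⟩
  else ACon.triv tb.K

/-- Family 1: virtual phase 2 records. [folklore] -/
def famRecV2 (r : ℕ) : ACon tb.K :=
  if r < 2 * tb.n + 2 then
    match v2src tb.n r with
    | .inl b => ⟨rv tb tb.inp 0 (tb.Y + r) fT1, rv tb tb.inp 0 (tb.Y + r) fT0,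
        rv tb tb.inp 0 (tb.Y + r) fSym, .dummy, .dummy, .dummy,
        fun t1 t0 sy _ _ _ => decide (t1 = false ∧ t0 = true ∧ sy = b)⟩
    | .inr j => ⟨rv tb tb.inp 0 (tb.Y + r) fT1, rv tb tb.inp 0 (tb.Y + r) fT0,
        rv tb tb.inp 0 (tb.Y + r) fSym, .x j, .dummy, .dummy,
        fun t1 t0 sy xj _ _ => decide (t1 = false ∧ t0 = true ∧ sy = xj)⟩
  else ACon.triv tb.K

/-- `NopSlot` is decidable. [folklore] -/
instance (κ : Fin tb.K) (s : ℕ) : Decidable (NopSlot tb κ s) := by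
  unfold NopSlot; infer_instance

/-- Family 2: scheduled idle records. [folklore] -/
def famRecNop (κ : Fin tb.K) (s : ℕ) : ACon tb.K :=
  if s < tb.S ∧ NopSlot tb κ s then
    ⟨rv tb κ 0 s fT1, rv tb κ 0 s fT0, .dummy, .dummy, .dummy, .dummy,
      fun t1 t0 _ _ _ _ => decide (t1 = false ∧ t0 = false)⟩
  else ACon.triv tb.K

/-- The machine-phase record specification as a Boolean. [folklore] -/
def mspecB (κ : Fin tb.K) (q : ℕ) (t1 t0 sy : Bool) : Prop :=
  match tb.P[q]? with
  | some (.push κ' a) => if κ' = κ then t1 = false ∧ t0 = true ∧ sy = a else t1 = false ∧ t0 = false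
  | some (.pop κ' _) => if κ' = κ then t1 = true else t1 = false ∧ t0 = false
  | _ => t1 = false ∧ t0 = false

/-- `mspecB` is decidable. [folklore] -/
instance (κ : Fin tb.K) (q : ℕ) (t1 t0 sy : Bool) : Decidable (mspecB tb κ q t1 t0 sy) := by
  unfold mspecB
  rcases tb.P[q]? with _ | ⟨k, a⟩ | ⟨k, j⟩ | ⟨j⟩ <;> simp only [] <;> infer_instance

/-- Family 3: machine-phase records. [folklore] -/
def famRecM (κ : Fin tb.K) (s q : ℕ) : ACon tb.K :=
  if tb.I ≤ s ∧ s < tb.Send ∧ q ≤ tb.np then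
    ⟨.u s q, rv tb κ 0 s fT1, rv tb κ 0 s fT0, rv tb κ 0 s fSym, .dummy, .dummy,
      fun u t1 t0 sy _ _ => decide (u = true → mspecB tb κ q t1 t0 sy)⟩
  else ACon.triv tb.K

/-- Family 4: the final check. [folklore] -/
def famRecF : ACon tb.K :=
  ⟨rv tb tb.out 0 tb.Send fT1, rv tb tb.out 0 tb.Send fT0, rv tb tb.out 0 tb.Send fSym, .dummy,
    .dummy, .dummy, fun t1 t0 sy _ _ _ => decide (t1 = true ∧ t0 = true ∧ sy = true)⟩

/-- Family 5: time bits. [folklore] -/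
def famTime (κ : Fin tb.K) (s j : ℕ) : ACon tb.K :=
  if s < tb.S ∧ j < tb.k then
    ⟨rv tb κ 0 s (tb.fTim j), .dummy, .dummy, .dummy, .dummy, .dummy,
      fun v _ _ _ _ _ => decide (v = ThreeCNF.bit j s)⟩
  else ACon.triv tb.K

/-- Family 6: level bits. [folklore] -/
def famLev (κ : Fin tb.K) (s j : ℕ) : ACon tb.K :=
  if s < tb.S ∧ j ≤ tb.k then
    ⟨rv tb κ 0 s fT1, rv tb κ 0 s fT0, rv tb κ 0 s (fLev j), .h κ (s + 1) j, .h κ s j, .dummy,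
      fun t1 t0 lv h' h _ => decide (lv = (if t1 = false ∧ t0 = true then h'
        else if t1 = true ∧ t0 = true then h else false))⟩
  else ACon.triv tb.K

/-- Family 7: initial heights. [folklore] -/
def famH0 (κ : Fin tb.K) (j : ℕ) : ACon tb.K :=
  if j ≤ tb.k then ⟨.h κ 0 j, .dummy, .dummy, .dummy, .dummy, .dummy,
    fun h _ _ _ _ _ => decide (h = false)⟩
  else ACon.triv tb.K

/-- Family 8: chains start at `1`. [folklore] -/
def famHc0 (κ : Fin tb.K) (s : ℕ) : ACon tb.K :=
  if s < tb.S then ⟨.hc κ s 0, .dummy, .dummy, .dummy, .dummy, .dummy,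
    fun c _ _ _ _ _ => decide (c = true)⟩
  else ACon.triv tb.K

/-- Family 9: no overflow / underflow. [folklore] -/
def famHcK (κ : Fin tb.K) (s : ℕ) : ACon tb.K :=
  if s < tb.S then ⟨rv tb κ 0 s fT0, .hc κ s (tb.k + 1), .dummy, .dummy, .dummy, .dummy,
    fun t0 c _ _ _ _ => decide (t0 = true → c = false)⟩
  else ACon.triv tb.K

/-- `HStepRel` is decidable. [folklore] -/
instance (t1 t0 a c a' c' : Bool) : Decidable (HStepRel t1 t0 a c a' c') := by
  unfold HStepRel; cases t1 <;> cases t0 <;> simp only [] <;> infer_instance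

/-- Family 10: the height update. [folklore] -/
def famHstep (κ : Fin tb.K) (s j : ℕ) : ACon tb.K :=
  if s < tb.S ∧ j ≤ tb.k then
    ⟨rv tb κ 0 s fT1, rv tb κ 0 s fT0, .h κ s j, .hc κ s j, .h κ (s + 1) j, .hc κ s (j + 1),
      fun t1 t0 a c a' c' => decide (HStepRel t1 t0 a c a' c')⟩
  else ACon.triv tb.K

/-- Family 11: start address. [folklore] -/
def famU0 : ACon tb.K :=
  ⟨.u tb.I 0, .dummy, .dummy, .dummy, .dummy, .dummy, fun u _ _ _ _ _ => decide (u = true)⟩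

/-- Family 12: at most one address. [folklore] -/
def famU2 (s q q' : ℕ) : ACon tb.K :=
  if tb.I ≤ s ∧ s ≤ tb.Send ∧ q < q' ∧ q' ≤ tb.np then
    ⟨.u s q, .u s q', .dummy, .dummy, .dummy, .dummy,
      fun u u' _ _ _ _ => decide (¬ (u = true ∧ u' = true))⟩
  else ACon.triv tb.K

/-- The popped claim pattern `o < 3`: `none`, `some false`, `some true`. [folklore] -/
def oPat (o : ℕ) : Option Bool := if o = 0 then none else if o = 1 then some false else some true

/-- Family 13: transitions, one constraint per claim pattern. [folklore] -/
def famTr (s q o : ℕ) : ACon tb.K :=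
  if tb.I ≤ s ∧ s < tb.Send ∧ q ≤ tb.np ∧ o < 3 then
    match tb.P[q]? with
    | some (.pop κ' _) =>
      let tgt := target tb q (oPat o)
      ⟨.u s q, rv tb κ' 0 s fT0, rv tb κ' 0 s fSym, (if tgt ≤ tb.np then .u (s + 1) tgt else .dummy),
        .dummy, .dummy, fun u t0 sy u' _ _ => decide ((u = true ∧
          (if t0 then some sy else none) = oPat o) → (tgt ≤ tb.np ∧ u' = true))⟩
    | _ =>
      if o = 0 then
        let tgt := target tb q none
        ⟨.u s q, (if tgt ≤ tb.np then .u (s + 1) tgt else .dummy), .dummy, .dummy, .dummy, .dummy,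
          fun u u' _ _ _ _ => decide (u = true → (tgt ≤ tb.np ∧ u' = true))⟩
      else ACon.triv tb.K
  else ACon.triv tb.K

/-- Family 14: acceptance. [folklore] -/
def famAcc : ACon tb.K :=
  ⟨.u tb.Send tb.np, .dummy, .dummy, .dummy, .dummy, .dummy, fun u _ _ _ _ _ => decide (u = true)⟩

/-- Family 15: the networks. [folklore] -/
def famNet (κ : Fin tb.K) (p ℓ w : ℕ) : ACon tb.K :=
  if ℓ < tb.L ∧ p < tb.S ∧ w < tb.W then
    ⟨rv tb κ (ℓ + 1) p w, .sw κ ℓ (base (tb.dim ℓ) p), rv tb κ ℓ (flipBit (tb.dim ℓ) p) w,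
      rv tb κ ℓ p w, .dummy, .dummy, fun r' s rf r _ _ => decide (r' = if s then rf else r)⟩
  else ACon.triv tb.K

/-- Family 16: comparison chains start at `0`. [folklore] -/
def famLt0 (κ : Fin tb.K) (p : ℕ) : ACon tb.K :=
  if p + 1 < tb.S then ⟨.lt κ p 0, .dummy, .dummy, .dummy, .dummy, .dummy,
    fun l _ _ _ _ _ => decide (l = false)⟩
  else ACon.triv tb.K

/-- Family 17: comparison chain steps. [folklore] -/
def famLtStep (κ : Fin tb.K) (p i : ℕ) : ACon tb.K :=
  if p + 1 < tb.S ∧ i < 2 * tb.k + 1 then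
    ⟨.lt κ p (i + 1), rv tb κ tb.L p (tb.fKey i), rv tb κ tb.L (p + 1) (tb.fKey i), .lt κ p i,
      .dummy, .dummy, fun l' a b l _ _ => decide (l' = if a = b then l else b)⟩
  else ACon.triv tb.K

/-- Family 18: strict increase. [folklore] -/
def famLtF (κ : Fin tb.K) (p : ℕ) : ACon tb.K :=
  if p + 1 < tb.S then ⟨.lt κ p (2 * tb.k + 1), .dummy, .dummy, .dummy, .dummy, .dummy,
    fun l _ _ _ _ _ => decide (l = true)⟩
  else ACon.triv tb.K

/-- Family 19: level-equality chains start at `1`. [folklore] -/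
def famAe0 (κ : Fin tb.K) (p : ℕ) : ACon tb.K :=
  if p + 1 < tb.S then ⟨.ae κ p 0, .dummy, .dummy, .dummy, .dummy, .dummy,
    fun e _ _ _ _ _ => decide (e = true)⟩
  else ACon.triv tb.K

/-- Family 20: level-equality chain steps. [folklore] -/
def famAeStep (κ : Fin tb.K) (p j : ℕ) : ACon tb.K :=
  if p + 1 < tb.S ∧ j ≤ tb.k then
    ⟨.ae κ p (j + 1), .ae κ p j, rv tb κ tb.L p (fLev j), rv tb κ tb.L (p + 1) (fLev j), .dummy,
      .dummy, fun e' e a b _ _ => decide (e' = (e && (a == b)))⟩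
  else ACon.triv tb.K

/-- Family 21: a pop is preceded by a push of the same level. [folklore] -/
def famAdj1 (κ : Fin tb.K) (p : ℕ) : ACon tb.K :=
  if p + 1 < tb.S then
    ⟨rv tb κ tb.L (p + 1) fT1, rv tb κ tb.L (p + 1) fT0, rv tb κ tb.L p fT1, rv tb κ tb.L p fT0,
      .ae κ p (tb.k + 1), .dummy, fun t1' t0' t1 t0 e _ =>
        decide (t1' = true → t0' = true → (t1 = false ∧ t0 = true ∧ e = true))⟩
  else ACon.triv tb.K

/-- Family 22: … and of the same symbol. [folklore] -/
def famAdj2 (κ : Fin tb.K) (p : ℕ) : ACon tb.K :=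
  if p + 1 < tb.S then
    ⟨rv tb κ tb.L (p + 1) fT1, rv tb κ tb.L (p + 1) fT0, rv tb κ tb.L p fSym,
      rv tb κ tb.L (p + 1) fSym, .dummy, .dummy,
      fun t1' t0' sy sy' _ _ => decide (t1' = true → t0' = true → sy = sy')⟩
  else ACon.triv tb.K

/-- Family 23: the first output record is not a pop. [folklore] -/
def famFirst (κ : Fin tb.K) : ACon tb.K :=
  ⟨rv tb κ tb.L 0 fT1, rv tb κ tb.L 0 fT0, .dummy, .dummy, .dummy, .dummy,
    fun t1 t0 _ _ _ _ => decide (¬ (t1 = true ∧ t0 = true))⟩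

/-- Radix of the time-like index of the flat family (covers times `≤ S`). [folklore] -/
def TabParams.S2 (tb : TabParams) : ℕ := 2 * tb.S

/-- Radix of the small indices of the flat family. [folklore] -/
def TabParams.D (tb : TabParams) : ℕ := tb.W + tb.np + 2

/-- The family dispatch of the flat family at a genuine register. [folklore] -/
def conCore (fam : ℕ) (κ : Fin tb.K) (si ai bi : ℕ) : ACon tb.K :=
  match fam with
  | 0 => famRecV1 tb si
  | 1 => famRecV2 tb si
  | 2 => famRecNop tb κ si
  | 3 => famRecM tb κ si ai
  | 4 => famRecF tb
  | 5 => famTime tb κ si ai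
  | 6 => famLev tb κ si ai
  | 7 => famH0 tb κ ai
  | 8 => famHc0 tb κ si
  | 9 => famHcK tb κ si
  | 10 => famHstep tb κ si ai
  | 11 => famU0 tb
  | 12 => famU2 tb si ai bi
  | 13 => famTr tb si ai bi
  | 14 => famAcc tb
  | 15 => famNet tb κ si ai bi
  | 16 => famLt0 tb κ si
  | 17 => famLtStep tb κ si ai
  | 18 => famLtF tb κ si
  | 19 => famAe0 tb κ si
  | 20 => famAeStep tb κ si ai
  | 21 => famAdj1 tb κ si
  | 22 => famAdj2 tb κ si
  | 23 => famFirst tb κ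
  | _ => ACon.triv tb.K

/-- **The flat family of constraints**: family `fam < 24` at register index `κi`, time-like
index `si` and small indices `ai`, `bi`; trivial outside the index box
`fam < 32, κi < K, si < S2, ai < D, bi < D`. [cite: FortnowEtAl2005, §3.1] -/
def conOf (fam κi si ai bi : ℕ) : ACon tb.K :=
  if hκ : κi < tb.K then
    (if fam < 32 ∧ si < tb.S2 ∧ ai < tb.D ∧ bi < tb.D then conCore tb fam ⟨κi, hκ⟩ si ai bi
     else ACon.triv tb.K)
  else ACon.triv tb.K

end Families

/-! ### `TabOK` is the conjunction of the flat family -/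

section Flat

variable {tb : TabParams} {τ : TabVar tb.K → Bool}

/-- Accessing the flat family at a genuine register. [folklore] -/
theorem conOf_fin (κ : Fin tb.K) {fam si ai bi : ℕ} (hf : fam < 32) (hs : si < tb.S2) (ha : ai < tb.D)
    (hb : bi < tb.D) : conOf tb fam κ.val si ai bi = conCore tb fam κ si ai bi := by
  unfold conOf; rw [dif_pos κ.2, if_pos ⟨hf, hs, ha, hb⟩]

/-- `mspecB` on the record bits is `MSpec`. [folklore] -/
theorem mspecB_iff (κ : Fin tb.K) (q s : ℕ) :
    mspecB tb κ q (R tb τ κ 0 s fT1) (R tb τ κ 0 s fT0) (R tb τ κ 0 s fSym) ↔ MSpec tb τ κ q s := by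
  unfold mspecB MSpec
  rcases tb.P[q]? with _ | ⟨k, a⟩ | ⟨k, j⟩ | ⟨j⟩ <;> exact Iff.rfl

/-- The pattern number of an optional bit. [folklore] -/
def patOf : Option Bool → ℕ
  | none => 0
  | some false => 1
  | some true => 2

/-- `patOf_lt` (auxiliary). [folklore] -/
theorem patOf_lt (o : Option Bool) : patOf o < 3 := by rcases o with _ | _ | _ <;> decide

/-- `oPat_patOf` (auxiliary). [folklore] -/
@[simp] theorem oPat_patOf (o : Option Bool) : oPat (patOf o) = o := by
  rcases o with _ | _ | _ <;> rfl

/-- **From the flat family to `TabOK`.** [folklore] -/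
theorem tabOK_of_forall (hfit : tb.Send < tb.S) (h : ∀ fam κi si ai bi, (conOf tb fam κi si ai bi).Sat τ) :
    TabOK tb τ := by
  have hκ0 : 0 < tb.K := tb.inp.pos
  have hS2 : tb.S2 = 2 * tb.S := rfl
  have hD : tb.D = tb.W + tb.np + 2 := rfl
  have hW : tb.W = 2 * tb.k + 4 := rfl
  have hL : tb.L = 2 * tb.k := rfl
  have hI : tb.I = tb.Y + (2 * tb.n + 2) := rfl
  have hSe : tb.Send = tb.I + tb.T := rfl
  have hS : 0 < tb.S := Nat.two_pow_pos _
  refine {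
    recV1 := fun s hs => ?_
    recV2 := fun r hr => ?_
    recNop := fun κ s hs hnop => ?_
    recM := fun κ s h1 h2 q hq hu => ?_
    recF := ?_
    time := fun κ s hs j hj => ?_
    lev := fun κ s hs j hj => ?_
    h0 := fun κ j hj => ?_
    hc0 := fun κ s hs => ?_
    hcK := fun κ s hs h0 => ?_
    hstep := fun κ s hs j hj => ?_
    u0 := ?_
    u2 := fun s h1 h2 q q' hqq hq' => ?_
    tr := fun s h1 h2 q hq hu => ?_
    acc := ?_
    net := fun κ ℓ hℓ p hp w hw => ?_
    lt0 := fun κ p hp => ?_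
    ltStep := fun κ p hp i hi => ?_
    ltF := fun κ p hp => ?_
    ae0 := fun κ p hp => ?_
    aeStep := fun κ p hp j hj => ?_
    adj1 := fun κ p hp h1 h0 => ?_
    adj2 := fun κ p hp h1 h0 => ?_
    first := fun κ => ?_ }
  · have := h 0 tb.inp.val s 0 0
    rw [conOf_fin _ (by omega) (by omega) (by omega) (by omega)] at this
    simp only [conCore] at this
    simp only [famRecV1, if_pos hs, ACon.Sat, decide_eq_true_eq] at this; exact this
  · have := h 1 tb.inp.val r 0 0
    rw [conOf_fin _ (by omega) (by omega) (by omega) (by omega)] at this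
    simp only [conCore] at this
    simp only [famRecV2, if_pos hr] at this
    revert this
    cases hv : v2src tb.n r with
    | inl b => intro this; simp only [ACon.Sat, decide_eq_true_eq] at this; exact this
    | inr j => intro this; simp only [ACon.Sat, decide_eq_true_eq] at this; exact this
  · have := h 2 κ.val s 0 0
    rw [conOf_fin _ (by omega) (by omega) (by omega) (by omega)] at this
    simp only [conCore] at this
    simp only [famRecNop, if_pos (show s < tb.S ∧ NopSlot tb κ s from ⟨hs, hnop⟩), ACon.Sat,
      decide_eq_true_eq] at this; exact this
  · have := h 3 κ.val s q 0
    rw [conOf_fin _ (by omega) (by omega) (by omega) (by omega)] at this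
    simp only [conCore] at this
    simp only [famRecM, if_pos (show tb.I ≤ s ∧ s < tb.Send ∧ q ≤ tb.np from ⟨h1, h2, hq⟩), ACon.Sat,
      decide_eq_true_eq] at this
    exact (mspecB_iff κ q s).1 (this hu)
  · have := h 4 tb.inp.val 0 0 0
    rw [conOf_fin _ (by omega) (by omega) (by omega) (by omega)] at this
    simp only [conCore] at this
    simp only [famRecF, ACon.Sat, decide_eq_true_eq] at this; exact this
  · have := h 5 κ.val s j 0
    rw [conOf_fin _ (by omega) (by omega) (by omega) (by omega)] at this
    simp only [conCore] at this
    simp only [famTime, if_pos (show s < tb.S ∧ j < tb.k from ⟨hs, hj⟩), ACon.Sat,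
      decide_eq_true_eq] at this; exact this
  · have := h 6 κ.val s j 0
    rw [conOf_fin _ (by omega) (by omega) (by omega) (by omega)] at this
    simp only [conCore] at this
    simp only [famLev, if_pos (show s < tb.S ∧ j ≤ tb.k from ⟨hs, hj⟩), ACon.Sat,
      decide_eq_true_eq] at this; exact this
  · have := h 7 κ.val 0 j 0
    rw [conOf_fin _ (by omega) (by omega) (by omega) (by omega)] at this
    simp only [conCore] at this
    simp only [famH0, if_pos hj, ACon.Sat, decide_eq_true_eq] at this; exact this
  · have := h 8 κ.val s 0 0
    rw [conOf_fin _ (by omega) (by omega) (by omega) (by omega)] at this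
    simp only [conCore] at this
    simp only [famHc0, if_pos hs, ACon.Sat, decide_eq_true_eq] at this; exact this
  · have := h 9 κ.val s 0 0
    rw [conOf_fin _ (by omega) (by omega) (by omega) (by omega)] at this
    simp only [conCore] at this
    simp only [famHcK, if_pos hs, ACon.Sat, decide_eq_true_eq] at this; exact this h0
  · have := h 10 κ.val s j 0
    rw [conOf_fin _ (by omega) (by omega) (by omega) (by omega)] at this
    simp only [conCore] at this
    simp only [famHstep, if_pos (show s < tb.S ∧ j ≤ tb.k from ⟨hs, hj⟩), ACon.Sat,
      decide_eq_true_eq] at this; exact this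
  · have := h 11 tb.inp.val 0 0 0
    rw [conOf_fin _ (by omega) (by omega) (by omega) (by omega)] at this
    simp only [conCore] at this
    simp only [famU0, ACon.Sat, decide_eq_true_eq] at this; exact this
  · have := h 12 tb.inp.val s q q'
    rw [conOf_fin _ (by omega) (by omega) (by omega) (by omega)] at this
    simp only [conCore] at this
    simp only [famU2, if_pos (show tb.I ≤ s ∧ s ≤ tb.Send ∧ q < q' ∧ q' ≤ tb.np from ⟨h1, h2, hqq, hq'⟩),
      ACon.Sat, decide_eq_true_eq] at this; exact this
  · -- transitions
    have hrange : ∀ o < 3, tb.I ≤ s ∧ s < tb.Send ∧ q ≤ tb.np ∧ o < 3 := fun o ho => ⟨h1, h2, hq, ho⟩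
    unfold oClaim
    simp only [R]
    rcases hP : tb.P[q]? with _ | ⟨k, a⟩ | ⟨k, j⟩ | ⟨j⟩
    · have := h 13 tb.inp.val s q 0
      rw [conOf_fin _ (by omega) (by omega) (by omega) (by omega)] at this
      simp only [conCore] at this
      simp only [famTr, if_pos (hrange 0 (by decide)), hP, if_true, ACon.Sat, decide_eq_true_eq] at this
      obtain ⟨ht, hu'⟩ := this hu
      rw [if_pos ht] at hu'; exact ⟨ht, hu'⟩
    · have := h 13 tb.inp.val s q 0
      rw [conOf_fin _ (by omega) (by omega) (by omega) (by omega)] at this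
      simp only [conCore] at this
      simp only [famTr, if_pos (hrange 0 (by decide)), hP, if_true, ACon.Sat, decide_eq_true_eq] at this
      obtain ⟨ht, hu'⟩ := this hu
      rw [if_pos ht] at hu'; exact ⟨ht, hu'⟩
    · simp only []
      set o := (if τ (.r k 0 s fT0) = true then some (τ (.r k 0 s fSym)) else none) with ho
      have hpo := patOf_lt o
      have := h 13 tb.inp.val s q (patOf o)
      rw [conOf_fin _ (by omega) (by omega) (by omega) (by omega)] at this
      simp only [conCore] at this
      simp only [famTr, if_pos (hrange _ (patOf_lt o)), hP, ACon.Sat, decide_eq_true_eq,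
        oPat_patOf, rv] at this
      obtain ⟨ht, hu'⟩ := this ⟨hu, ho.symm⟩
      rw [if_pos ht] at hu'; exact ⟨ht, hu'⟩
    · have := h 13 tb.inp.val s q 0
      rw [conOf_fin _ (by omega) (by omega) (by omega) (by omega)] at this
      simp only [conCore] at this
      simp only [famTr, if_pos (hrange 0 (by decide)), hP, if_true, ACon.Sat, decide_eq_true_eq] at this
      obtain ⟨ht, hu'⟩ := this hu
      rw [if_pos ht] at hu'; exact ⟨ht, hu'⟩
  · have := h 14 tb.inp.val 0 0 0
    rw [conOf_fin _ (by omega) (by omega) (by omega) (by omega)] at this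
    simp only [conCore] at this
    simp only [famAcc, ACon.Sat, decide_eq_true_eq] at this; exact this
  · have := h 15 κ.val p ℓ w
    rw [conOf_fin _ (by omega) (by omega) (by omega) (by omega)] at this
    simp only [conCore] at this
    simp only [famNet, if_pos (show ℓ < tb.L ∧ p < tb.S ∧ w < tb.W from ⟨hℓ, hp, hw⟩), ACon.Sat,
      decide_eq_true_eq] at this; exact this
  · have := h 16 κ.val p 0 0
    rw [conOf_fin _ (by omega) (by omega) (by omega) (by omega)] at this
    simp only [conCore] at this
    simp only [famLt0, if_pos hp, ACon.Sat, decide_eq_true_eq] at this; exact this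
  · have := h 17 κ.val p i 0
    rw [conOf_fin _ (by omega) (by omega) (by omega) (by omega)] at this
    simp only [conCore] at this
    simp only [famLtStep, if_pos (show p + 1 < tb.S ∧ i < 2 * tb.k + 1 from ⟨hp, hi⟩), ACon.Sat,
      decide_eq_true_eq] at this; exact this
  · have := h 18 κ.val p 0 0
    rw [conOf_fin _ (by omega) (by omega) (by omega) (by omega)] at this
    simp only [conCore] at this
    simp only [famLtF, if_pos hp, ACon.Sat, decide_eq_true_eq] at this; exact this
  · have := h 19 κ.val p 0 0
    rw [conOf_fin _ (by omega) (by omega) (by omega) (by omega)] at this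
    simp only [conCore] at this
    simp only [famAe0, if_pos hp, ACon.Sat, decide_eq_true_eq] at this; exact this
  · have := h 20 κ.val p j 0
    rw [conOf_fin _ (by omega) (by omega) (by omega) (by omega)] at this
    simp only [conCore] at this
    simp only [famAeStep, if_pos (show p + 1 < tb.S ∧ j ≤ tb.k from ⟨hp, hj⟩), ACon.Sat,
      decide_eq_true_eq] at this; exact this
  · have := h 21 κ.val p 0 0
    rw [conOf_fin _ (by omega) (by omega) (by omega) (by omega)] at this
    simp only [conCore] at this
    simp only [famAdj1, if_pos hp, ACon.Sat, decide_eq_true_eq] at this; exact this h1 h0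
  · have := h 22 κ.val p 0 0
    rw [conOf_fin _ (by omega) (by omega) (by omega) (by omega)] at this
    simp only [conCore] at this
    simp only [famAdj2, if_pos hp, ACon.Sat, decide_eq_true_eq] at this; exact this h1 h0
  · have := h 23 κ.val 0 0 0
    rw [conOf_fin _ (by omega) (by omega) (by omega) (by omega)] at this
    simp only [conCore] at this
    simp only [famFirst, ACon.Sat, decide_eq_true_eq] at this; exact this

/-- **From `TabOK` to the flat family.** [folklore] -/
theorem forall_of_tabOK (hT : TabOK tb τ) (fam κi si ai bi : ℕ) : (conOf tb fam κi si ai bi).Sat τ := by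
  unfold conOf
  by_cases hκ : κi < tb.K
  · rw [dif_pos hκ]
    by_cases hbox : fam < 32 ∧ si < tb.S2 ∧ ai < tb.D ∧ bi < tb.D
    swap
    · rw [if_neg hbox]; exact ACon.sat_triv τ
    rw [if_pos hbox]
    set κ : Fin tb.K := ⟨κi, hκ⟩
    unfold conCore
    match fam with
    | 0 =>
      show (famRecV1 tb si).Sat τ
      unfold famRecV1; split_ifs with h
      · simp only [ACon.Sat, decide_eq_true_eq]; exact hT.recV1 si h
      · exact ACon.sat_triv τ
    | 1 =>
      show (famRecV2 tb si).Sat τ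
      unfold famRecV2; split_ifs with h
      · have := hT.recV2 si h
        revert this
        cases v2src tb.n si with
        | inl b => intro this; simp only [ACon.Sat, decide_eq_true_eq]; exact this
        | inr j => intro this; simp only [ACon.Sat, decide_eq_true_eq]; exact this
      · exact ACon.sat_triv τ
    | 2 =>
      show (famRecNop tb κ si).Sat τ
      unfold famRecNop; split_ifs with h
      · simp only [ACon.Sat, decide_eq_true_eq]; exact hT.recNop κ si h.1 h.2
      · exact ACon.sat_triv τ
    | 3 =>
      show (famRecM tb κ si ai).Sat τ
      unfold famRecM; split_ifs with h
      · simp only [ACon.Sat, decide_eq_true_eq]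
        exact fun hu => (mspecB_iff κ ai si).2 (hT.recM κ si h.1 h.2.1 ai h.2.2 hu)
      · exact ACon.sat_triv τ
    | 4 =>
      show (famRecF tb).Sat τ
      simp only [famRecF, ACon.Sat, decide_eq_true_eq]; exact hT.recF
    | 5 =>
      show (famTime tb κ si ai).Sat τ
      unfold famTime; split_ifs with h
      · simp only [ACon.Sat, decide_eq_true_eq]; exact hT.time κ si h.1 ai h.2
      · exact ACon.sat_triv τ
    | 6 =>
      show (famLev tb κ si ai).Sat τ
      unfold famLev; split_ifs with h
      · simp only [ACon.Sat, decide_eq_true_eq]; exact hT.lev κ si h.1 ai h.2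
      · exact ACon.sat_triv τ
    | 7 =>
      show (famH0 tb κ ai).Sat τ
      unfold famH0; split_ifs with h
      · simp only [ACon.Sat, decide_eq_true_eq]; exact hT.h0 κ ai h
      · exact ACon.sat_triv τ
    | 8 =>
      show (famHc0 tb κ si).Sat τ
      unfold famHc0; split_ifs with h
      · simp only [ACon.Sat, decide_eq_true_eq]; exact hT.hc0 κ si h
      · exact ACon.sat_triv τ
    | 9 =>
      show (famHcK tb κ si).Sat τ
      unfold famHcK; split_ifs with h
      · simp only [ACon.Sat, decide_eq_true_eq]; exact hT.hcK κ si h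
      · exact ACon.sat_triv τ
    | 10 =>
      show (famHstep tb κ si ai).Sat τ
      unfold famHstep; split_ifs with h
      · simp only [ACon.Sat, decide_eq_true_eq]; exact hT.hstep κ si h.1 ai h.2
      · exact ACon.sat_triv τ
    | 11 =>
      show (famU0 tb).Sat τ
      simp only [famU0, ACon.Sat, decide_eq_true_eq]; exact hT.u0
    | 12 =>
      show (famU2 tb si ai bi).Sat τ
      unfold famU2; split_ifs with h
      · simp only [ACon.Sat, decide_eq_true_eq]; exact hT.u2 si h.1 h.2.1 ai bi h.2.2.1 h.2.2.2
      · exact ACon.sat_triv τ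
    | 13 =>
      show (famTr tb si ai bi).Sat τ
      unfold famTr
      by_cases h : tb.I ≤ si ∧ si < tb.Send ∧ ai ≤ tb.np ∧ bi < 3
      · rw [if_pos h]
        have htr := hT.tr si h.1 h.2.1 ai h.2.2.1
        unfold oClaim at htr
        simp only [R, rv] at htr ⊢
        rcases hP : tb.P[ai]? with _ | ⟨k, a⟩ | ⟨k, j⟩ | ⟨j⟩ <;> simp only [hP] at htr ⊢
        · by_cases hb : bi = 0
          · rw [if_pos hb]; simp only [ACon.Sat, decide_eq_true_eq]
            intro hu; obtain ⟨ht, hu'⟩ := htr hu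
            rw [if_pos ht]; exact ⟨ht, hu'⟩
          · rw [if_neg hb]; exact ACon.sat_triv τ
        · by_cases hb : bi = 0
          · rw [if_pos hb]; simp only [ACon.Sat, decide_eq_true_eq]
            intro hu; obtain ⟨ht, hu'⟩ := htr hu
            rw [if_pos ht]; exact ⟨ht, hu'⟩
          · rw [if_neg hb]; exact ACon.sat_triv τ
        · simp only [ACon.Sat, decide_eq_true_eq]
          rintro ⟨hu, hoc⟩
          rw [hoc] at htr
          obtain ⟨ht, hu'⟩ := htr hu
          rw [if_pos ht]; exact ⟨ht, hu'⟩
        · by_cases hb : bi = 0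
          · rw [if_pos hb]; simp only [ACon.Sat, decide_eq_true_eq]
            intro hu; obtain ⟨ht, hu'⟩ := htr hu
            rw [if_pos ht]; exact ⟨ht, hu'⟩
          · rw [if_neg hb]; exact ACon.sat_triv τ
      · rw [if_neg h]; exact ACon.sat_triv τ
    | 14 =>
      show (famAcc tb).Sat τ
      simp only [famAcc, ACon.Sat, decide_eq_true_eq]; exact hT.acc
    | 15 =>
      show (famNet tb κ si ai bi).Sat τ
      unfold famNet; split_ifs with h
      · simp only [ACon.Sat, decide_eq_true_eq]; exact hT.net κ ai h.1 si h.2.1 bi h.2.2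
      · exact ACon.sat_triv τ
    | 16 =>
      show (famLt0 tb κ si).Sat τ
      unfold famLt0; split_ifs with h
      · simp only [ACon.Sat, decide_eq_true_eq]; exact hT.lt0 κ si h
      · exact ACon.sat_triv τ
    | 17 =>
      show (famLtStep tb κ si ai).Sat τ
      unfold famLtStep; split_ifs with h
      · simp only [ACon.Sat, decide_eq_true_eq]; exact hT.ltStep κ si h.1 ai h.2
      · exact ACon.sat_triv τ
    | 18 =>
      show (famLtF tb κ si).Sat τ
      unfold famLtF; split_ifs with h
      · simp only [ACon.Sat, decide_eq_true_eq]; exact hT.ltF κ si h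
      · exact ACon.sat_triv τ
    | 19 =>
      show (famAe0 tb κ si).Sat τ
      unfold famAe0; split_ifs with h
      · simp only [ACon.Sat, decide_eq_true_eq]; exact hT.ae0 κ si h
      · exact ACon.sat_triv τ
    | 20 =>
      show (famAeStep tb κ si ai).Sat τ
      unfold famAeStep; split_ifs with h
      · simp only [ACon.Sat, decide_eq_true_eq]; exact hT.aeStep κ si h.1 ai h.2
      · exact ACon.sat_triv τ
    | 21 =>
      show (famAdj1 tb κ si).Sat τ
      unfold famAdj1; split_ifs with h
      · simp only [ACon.Sat, decide_eq_true_eq]; exact hT.adj1 κ si h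
      · exact ACon.sat_triv τ
    | 22 =>
      show (famAdj2 tb κ si).Sat τ
      unfold famAdj2; split_ifs with h
      · simp only [ACon.Sat, decide_eq_true_eq]; exact hT.adj2 κ si h
      · exact ACon.sat_triv τ
    | 23 =>
      show (famFirst tb κ).Sat τ
      simp only [famFirst, ACon.Sat, decide_eq_true_eq]; exact hT.first κ
    | n + 24 => exact ACon.sat_triv τ
  · rw [dif_neg hκ]; exact ACon.sat_triv τ

/-- **`TabOK` is the conjunction of the flat family of constraints.** [cite: FortnowEtAl2005, §3.1] -/
theorem tabOK_iff (hfit : tb.Send < tb.S) : TabOK tb τ ↔ ∀ fam κi si ai bi, (conOf tb fam κi si ai bi).Sat τ :=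
  ⟨fun hT => forall_of_tabOK hT, tabOK_of_forall hfit⟩

end Flat

end Tableau

end Literature.Computability.Complexity
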